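import Literature.AlgebraicGeometry.ModuliOfAbelianVarieties.SiegelFineModuliArtinianLiftingPolarized
import Literature.AlgebraicGeometry.ModuliOfAbelianVarieties.SiegelFineModuliArtinianLiftingPrincipal
import HarnessLib

/-!
# The `hF11` junction over PRINCIPAL small extensions with residue-finite test algebras:
# polarised lifts of the LEVEL-FREE triple along `A ↠ A⧸(t)` ⟹ `Smooth 𝓜.M.hom`
# ([EGAIV4] (17.14.2) + [Schlessinger1968] (1.2)–(1.3), through «fine moduli» [MumfordFogartyKirwan1994] Thm. 7.9)

Layer `Literature/AlgebraicGeometry/ModuliOfAbelianVarieties`, namespace `…ModuliOfAbelianVarieties.SiegelFineModuliScheme`.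
THEOREMS ONLY (one head; no definition, no instance, no notation, no named fact, no `sorry`).  Cell `hodgecm-mathlib` FLOOR 0, P1
sub-line F-11 ROAD A, junction sharpening J2 = (a)+(b) (F0P1b-p01 (g0); author of the line B-p05 (g19), who ruled 22:28Z «(A2♯) =
separate file» so that ★ `SiegelFineModuliArtinianLiftingPolarized` (his (A2)) stays as vetted).

THE POINT.  ★ `SiegelFineModuliArtinianLiftingPolarized` §2 `PolarizedAbelianSchemeWithLevel.exists_isBaseChangeVia_of_polarizedLift`
(B-p05): a LEVEL-FREE polarised lift `(X, D, λ, G, Ĝ)` of a test triple `P₀` along a surjective closed immersion IS a lift of the triple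
(the level structure lifts uniquely [SGA1] I 5.6; type ∕ symplectic clauses transfer; second normalisation by `DualPair.normalize`).
★ `SiegelFineModuliArtinianLiftingPrincipal` (A6♯): lifting of triples along PRINCIPAL small extensions `A ↠ A⧸(t)` (`t ∈ 𝔪_A`, `t ≠ 0`,
`𝔪_A·t = 0`) of Artinian local `ℚ`-algebras with residue field FINITE over `ℚ` ⟹ `Smooth 𝓜.M.hom`.  Composing the two:

* **`smooth_of_forall_principalSmallExtension_exists_polarizedLift`** (A2♯) — the `hF11` junction of road A in the letter the producers
  (α1 `stub_liftWithLineBundle`, αP, α2′ of `Cruxes/HDel/Lines/F11SmoothRoadA` ED. 3′) discharge: for every such `(A, t)` and every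
  triple `P₀` over `Spec (A⧸(t))`, the level-free polarised abelian scheme `(P₀.A, P₀.D, P₀.pol)` lifts to `Spec A` (relation form
  `IsBaseChangeVia`, Poincaré clause, `λ`-square) ⟹ `𝓜.M → Spec ℚ` is smooth (`N ≠ 0`).

## References
* [EGAIV4] A. Grothendieck, J. Dieudonné, *Éléments de géométrie algébrique* IV₄, Publ. Math. IHÉS 32 (1967), Prop. (17.14.2) (p. 98).
* [Schlessinger1968] M. Schlessinger, *Functors of Artin rings*, Trans. AMS 130 (1968), Def. (1.2), (1.3).
* [Hartshorne2010] R. Hartshorne, *Deformation Theory*, GTM 257 (2010), §16 pp. 111–113.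
* [MumfordFogartyKirwan1994] D. Mumford, J. Fogarty, F. Kirwan, *Geometric Invariant Theory*, 3rd ed. (1994), Ch. 7 §3 Thm. 7.9 (p. 139).
* [SGA1] A. Grothendieck, *SGA 1* (LNM 224), Exp. I Cor. 5.6.
-/

noncomputable section

universe u

open CategoryTheory CategoryTheory.Limits AlgebraicGeometry MonoidalCategory CartesianMonoidalCategory
open scoped MonObj

namespace Literature.AlgebraicGeometry.ModuliOfAbelianVarieties

open Literature.AlgebraicGeometry.Motives (SchemeOver specOver)
open Literature.AlgebraicGeometry.AbelianSchemes

namespace SiegelFineModuliScheme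

variable {g N : ℕ} {δ : Fin g → ℕ} (𝓜 : SiegelFineModuliScheme g N δ)

/-- **(A2♯) F-11 junction over PRINCIPAL small extensions:** if for every Artinian local `ℚ`-algebra `A`, every `t ∈ 𝔪_A` with
`t ≠ 0`, `𝔪_A·t = 0`, residue field of `A` finite over `ℚ`, and every triple `P₀` over `Spec (A⧸(t))` the LEVEL-FREE polarised abelian
scheme `(P₀.A, P₀.D, P₀.pol)` lifts to `Spec A` (relation form, Poincaré and `λ` clauses as in §3), then `𝓜.M → Spec ℚ` is smooth (`N ≠ 0`).  §2 + (A6♯)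
`smooth_of_forall_principalSmallExtension_exists_isBaseChangeVia`. [cite: EGAIV4, Prop. (17.14.2) p. 98]
[cite: MumfordFogartyKirwan1994, Ch. 7 §3 Theorem 7.9 (p. 139)] [cite: Hartshorne2010, §16, pp. 111–113 (small extensions; proof of Thm. 16.2)] -/
theorem smooth_of_forall_principalSmallExtension_exists_polarizedLift [LocallyOfFiniteType 𝓜.M.hom] (hN : N ≠ 0)
    (H : ∀ (A : Type) [CommRing A] [Algebra ℚ A] [IsArtinianRing A] [IsLocalRing A]
      [Module.Finite ℚ (IsLocalRing.ResidueField A)] (t : A),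
      t ≠ 0 → t ∈ IsLocalRing.maximalIdeal A → IsLocalRing.maximalIdeal A * Ideal.span {t} = ⊥ →
      ∀ P₀ : PolarizedAbelianSchemeWithLevel g N δ (Spec (.of (A ⧸ Ideal.span {t}))),
        ∃ (X : AbelianSchemeOver (Spec (.of A))) (_ : X.IsOfRelDim g) (D : X.DualPair) (pol : X.Polarization D)
          (G : P₀.A.X.left ⟶ X.X.left) (Ĝ : P₀.D.hat.X.left ⟶ D.hat.X.left)
          (hG : P₀.A.IsBaseChangeVia X (Spec.map (CommRingCat.ofHom (Ideal.Quotient.mk (Ideal.span {t})))) G)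
          (hĜ : P₀.D.hat.IsBaseChangeVia D.hat (Spec.map (CommRingCat.ofHom (Ideal.Quotient.mk (Ideal.span {t})))) Ĝ),
          Nonempty ((Scheme.Modules.pullback
            (pullback.map P₀.A.X.hom P₀.D.hat.X.hom X.X.hom D.hat.X.hom G Ĝ
              (Spec.map (CommRingCat.ofHom (Ideal.Quotient.mk (Ideal.span {t})))) hG.fst.symm hĜ.fst.symm)).obj D.P ≅
              P₀.D.P) ∧
          P₀.pol.lam.left ≫ Ĝ = G ≫ pol.lam.left) :
    Smooth 𝓜.M.hom := by
  refine 𝓜.smooth_of_forall_principalSmallExtension_exists_isBaseChangeVia fun A _ _ _ _ _ t ht0 htm htJ P₀ => ?_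
  obtain ⟨X, hX, D, pol, G, Ĝ, hG, hĜ, hP, hlam⟩ := H A t ht0 htm htJ P₀
  -- the thickening `Spec (A ⧸ (t)) → Spec A`: a surjective closed immersion (one point on each side)
  have hJtop : Ideal.span {t} ≠ ⊤ := fun h =>
    (IsLocalRing.mem_maximalIdeal _).mp htm (Ideal.span_singleton_eq_top.mp h)
  haveI : Nontrivial (A ⧸ Ideal.span {t}) := Ideal.Quotient.nontrivial_iff.mpr hJtop
  haveI : IsClosedImmersion (Spec.map (CommRingCat.ofHom (Ideal.Quotient.mk (Ideal.span {t})))) :=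
    IsClosedImmersion.spec_of_surjective _ Ideal.Quotient.mk_surjective
  haveI : Surjective (Spec.map (CommRingCat.ofHom (Ideal.Quotient.mk (Ideal.span {t})))) := ⟨by
    intro y
    obtain ⟨M, hM⟩ := Ideal.exists_maximal (A ⧸ Ideal.span {t})
    refine ⟨(⟨M, hM.isPrime⟩ : PrimeSpectrum (A ⧸ Ideal.span {t})), PrimeSpectrum.ext ?_⟩
    rw [IsLocalRing.eq_maximalIdeal (IsArtinianRing.isMaximal_of_isPrime y.asIdeal)]
    exact IsLocalRing.eq_maximalIdeal (IsArtinianRing.isMaximal_of_isPrime _)⟩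
  -- `[N]_X` is étale over the `ℚ`-algebra `A` (characteristic `0`, `N ≠ 0`)
  haveI := X.etale_pow_id_left_of_charZero (Spec.map (CommRingCat.ofHom (algebraMap ℚ A))) hN
  obtain ⟨P, G', Ĝ', -, hrel⟩ := PolarizedAbelianSchemeWithLevel.exists_isBaseChangeVia_of_polarizedLift
    (Spec.map (CommRingCat.ofHom (Ideal.Quotient.mk (Ideal.span {t})))) P₀ X hX D pol G Ĝ hG hĜ hP hlam
  exact ⟨P, G', Ĝ', hrel⟩

end SiegelFineModuliScheme

end Literature.AlgebraicGeometry.ModuliOfAbelianVarieties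

end
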